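import Summits.AtomisticToContinuum.FouriersLaw.Theorems.PhononMeanFreePathDefs
import Summits.AtomisticToContinuum.FouriersLaw.Theorems.PhononMeanFreePathCoherentDephasingRightBalance
import Summits.AtomisticToContinuum.FouriersLaw.Theorems.PhononMeanFreePathCoherentDephasingResponseRegularity

/-!
# Loss-bound composition of line `Sketch` (crux `PhononMeanFreePath.CoherentDephasing`, stmt-AtomisticToContinuum-11810)

Two helpers of skeleton v4 of line `Sketch` (coherent-field Beer–Lambert) of the crux `CoherentDephasing`
(`Cruxes/CoherentDephasing/Lines/Sketch.lean`), both registered stubs of the crux item: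

* `dissipation_le_geometric_loss` — PURE REAL ARITHMETIC on `ℕ`-indexed families: if beyond a head bond `L` the
  coherent flux `J` obeys the site balances `J (x-1) - J x = s x`, the local loss bound `κ E x ≤ s x` (`κ > 0`,
  `E ≥ 0`) and the transport bound `J b ≤ E b + E (b+1)`, then `J` is non-increasing and non-negative beyond the head
  and contracts by `1/(1+κ)` every two bonds (`J (x-1) - J (x+1) = s x + s (x+1) ≥ κ (E x + E (x+1)) ≥ κ J x ≥ κ J (x+1)`),
  so anything bounded by `A · E N` (the far-bath dissipation, `A = 2γ`) is at most `(A/κ)·B·(1+κ)^{-⌊(N-1-L)/2⌋}` when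
  `J L ≤ B`. This is the whole `N`-uniform composition of the line: with it, the crux along `Sketch` is the single
  local loss (FGR) bound `stub_localLossBound`.
* `integral_momResp_sq_le_two_cohEnergy` — fixed `N`: `∫₀^∞ m_x² ≤ 2 E_x` (`m_x² ≤ 2 e_x` pointwise and `e_x` is
  integrable on `(0,∞)` by the continuity/decay package `stub_responseRegularity`), which feeds `A = 2γ` above at the
  last site (`γ∫₀^∞ m_N² ≤ 2γ E_N`).
-/

noncomputable section

open MeasureTheory Set Filter Topology

namespace Summit.AtomisticToContinuum.FouriersLaw.Theorems.CoherentDephasing.LossComposition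

open Summit.AtomisticToContinuum.FouriersLaw.Theorems.PhononMeanFreePath
open Summit.AtomisticToContinuum.FouriersLaw.Theorems.CoherentDephasing.RightBalance
  (abs_mul_le_of_abs_le_exp abs_sub_le_of_abs_le integrableOn_Ioi_of_abs_le_exp)
open Summit.AtomisticToContinuum.FouriersLaw.Theorems.CoherentDephasing.ResponseRegularity (stub_responseRegularity)

/-- **Geometric decay of the coherent flux from a local loss bound** (abstract core of skeleton v4 of line `Sketch`).
Let `J, s, E : ℕ → ℝ` (flux through bond `b`, total local loss and time-integrated coherent energy at site `x` of an
`(N+1)`-site chain, `J N = 0` beyond the last bond) satisfy, beyond a head bond `L < N` with `J L ≤ B`: the site balances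
`J (x-1) - J x = s x` and the loss bound `κ E x ≤ s x` for `L < x ≤ N` (`κ > 0`), `E ≥ 0`, and the transport bound
`J b ≤ E b + E (b+1)` at every bond. Then the flux is non-increasing and non-negative beyond the head and contracts by
`1/(1+κ)` every two bonds, so any `D ≤ A·E N` (`A ≥ 0`) obeys `D ≤ (A/κ)·B·(1+κ)^{-⌊(N-1-L)/2⌋}`. [folklore] -/
theorem dissipation_le_geometric_loss :
    ∀ (J s E : ℕ → ℝ) (D A B κ : ℝ) (N L : ℕ), 0 < κ → 0 ≤ A → L + 1 ≤ N →
      J N = 0 → J L ≤ B →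
      (∀ x, L < x → x ≤ N → J (x - 1) - J x = s x) →
      (∀ x, L < x → x ≤ N → κ * E x ≤ s x) →
      (∀ x, 0 ≤ E x) →
      (∀ b, b + 1 ≤ N → J b ≤ E b + E (b + 1)) →
      D ≤ A * E N →
      D ≤ A / κ * B * (1 / (1 + κ)) ^ ((N - 1 - L) / 2) := by
  intro J s E D A B κ N L hκ hA hLN hJN hhead hbal hfgr hE htr hD
  set θ : ℝ := 1 / (1 + κ) with hθdef
  have hθ0 : 0 ≤ θ := by positivity
  -- monotonicity beyond the head: `J x ≤ J (x-1)` for `L < x ≤ N` (loss bound + `E ≥ 0`)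
  have hmono : ∀ x, L < x → x ≤ N → J x ≤ J (x - 1) := by
    intro x h1 h2
    have hb := hbal x h1 h2
    have hf := hfgr x h1 h2
    have he := hE x
    nlinarith
  -- chained: `J (a + k) ≤ J a` for `L ≤ a`, `a + k ≤ N`
  have hchain : ∀ k a, L ≤ a → a + k ≤ N → J (a + k) ≤ J a := by
    intro k
    induction k with
    | zero => intro a _ _; simp
    | succ k ih =>
      intro a ha hk
      have h1 : J (a + k + 1) ≤ J (a + k) := by
        have := hmono (a + k + 1) (by omega) (by omega)
        rwa [Nat.add_sub_cancel] at this
      have e : a + (k + 1) = a + k + 1 := by omega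
      rw [e]
      exact h1.trans (ih a ha (by omega))
  -- two-step contraction: `J (x+1) ≤ θ J (x-1)` for `L < x`, `x + 1 ≤ N`
  have hstep : ∀ x, L < x → x + 1 ≤ N → J (x + 1) ≤ θ * J (x - 1) := by
    intro x h1 h2
    have hb1 := hbal x h1 (by omega)
    have hb2 := hbal (x + 1) (by omega) h2
    rw [Nat.add_sub_cancel] at hb2
    have hf1 := hfgr x h1 (by omega)
    have hf2 := hfgr (x + 1) (by omega) h2
    have ht := htr x h2
    have hm := hmono (x + 1) (by omega) h2
    rw [Nat.add_sub_cancel] at hm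
    -- `J(x-1) - J(x+1) = s x + s (x+1) ≥ κ (E x + E (x+1)) ≥ κ J x ≥ κ J (x+1)`
    have hkey : J (x + 1) * (1 + κ) ≤ J (x - 1) := by nlinarith
    rw [hθdef, one_div_mul_eq_div, le_div_iff₀ (by positivity)]
    exact hkey
  -- iterate from the head bond
  have hiter : ∀ k, L + 2 * k ≤ N → J (L + 2 * k) ≤ θ ^ k * J L := by
    intro k
    induction k with
    | zero => intro _; simp
    | succ k ih =>
      intro hk
      have h1 := hstep (L + 2 * k + 1) (by omega) (by omega)
      rw [show L + 2 * k + 1 + 1 = L + 2 * (k + 1) by ring, Nat.add_sub_cancel] at h1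
      calc J (L + 2 * (k + 1)) ≤ θ * J (L + 2 * k) := h1
        _ ≤ θ * (θ ^ k * J L) := mul_le_mul_of_nonneg_left (ih (by omega)) hθ0
        _ = θ ^ (k + 1) * J L := by ring
  -- end game at the last site
  set k : ℕ := (N - 1 - L) / 2 with hk
  have hJend : J (N - 1) ≤ θ ^ k * B := by
    have h1 : J (N - 1) ≤ J (L + 2 * k) := by
      have := hchain (N - 1 - (L + 2 * k)) (L + 2 * k) (by omega) (by omega)
      rwa [show L + 2 * k + (N - 1 - (L + 2 * k)) = N - 1 by omega] at this
    have h2 : J (L + 2 * k) ≤ θ ^ k * J L := hiter k (by omega)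
    have h3 : θ ^ k * J L ≤ θ ^ k * B := mul_le_mul_of_nonneg_left hhead (pow_nonneg hθ0 k)
    linarith
  have hsN : κ * E N ≤ J (N - 1) := by
    have h1 := hfgr N (by omega) le_rfl
    have h2 := hbal N (by omega) le_rfl
    rw [hJN, sub_zero] at h2
    linarith
  have hEN : E N ≤ J (N - 1) / κ := by rw [le_div_iff₀ hκ]; linarith
  calc D ≤ A * E N := hD
    _ ≤ A * (J (N - 1) / κ) := mul_le_mul_of_nonneg_left hEN hA
    _ ≤ A * (θ ^ k * B / κ) := mul_le_mul_of_nonneg_left (div_le_div_of_nonneg_right hJend hκ.le) hA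
    _ = A / κ * B * θ ^ k := by ring

/-- **Kinetic energy is at most the site energy**, integrated: at fixed `N`, `∫₀^∞ m_x² ≤ 2 E_x` at every site of the
`(N+1)`-site chain (`m_x² ≤ 2 e_x` pointwise since `e_x = ½(m_x² + ω₂ n_x²) + ¼Σ(…)²` with `ω₂ ≥ 0`, and `e_x` is
integrable on `(0,∞)`: continuous, exponentially decaying `m, n` by `stub_responseRegularity`). [folklore] -/
theorem integral_momResp_sq_le_two_cohEnergy :
    ∀ ω₂ lam β γ : ℝ, 0 < ω₂ → 0 < lam → 0 < β → 0 < γ → ∀ T : ℝ, 0 < T → ∀ (N : ℕ) (x : Fin (N + 1)),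
      ∫ t in Set.Ioi (0 : ℝ), momResp ω₂ lam β γ T N x t ^ 2 ≤ 2 * cohEnergy ω₂ lam β γ T N x := by
  intro ω₂ lam β γ hω hl hβ hγ T hT N x
  obtain ⟨hcont, -, -, C, c, hc, hdec⟩ := stub_responseRegularity ω₂ lam β γ hω hl hβ hγ T hT N
  have hmc : ∀ y, Continuous (momResp ω₂ lam β γ T N y) := fun y => (hcont y).1
  have hnc : ∀ y, Continuous (posResp ω₂ lam β γ T N y) := fun y => (hcont y).2.1
  have hmb : ∀ (y : Fin (N + 1)) (t : ℝ), 0 ≤ t → |momResp ω₂ lam β γ T N y t| ≤ C * Real.exp (-c * t) :=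
    fun y t ht => ((hdec t ht).1 y).1
  have hnb : ∀ (y : Fin (N + 1)) (t : ℝ), 0 ≤ t → |posResp ω₂ lam β γ T N y t| ≤ C * Real.exp (-c * t) :=
    fun y t ht => ((hdec t ht).1 y).2.1
  -- squares of exponentially bounded continuous functions are integrable on `(0, ∞)`
  have hC : ∀ (f : ℝ → ℝ) (t : ℝ), |f t| ≤ C * Real.exp (-c * t) → |f t| ≤ (C + C) * Real.exp (-c * t) :=
    fun f t h => h.trans (by nlinarith [(abs_nonneg _).trans h, Real.exp_pos (-c * t)])
  have i2 : ∀ f : ℝ → ℝ, Continuous f → (∀ t, 0 ≤ t → |f t| ≤ (C + C) * Real.exp (-c * t)) →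
      IntegrableOn (fun t => f t ^ 2) (Ioi 0) := fun f hf hb => by
    refine integrableOn_Ioi_of_abs_le_exp (K := (C + C) * (C + C)) hc (hf.pow 2) fun t ht => ?_
    rw [sq]
    exact abs_mul_le_of_abs_le_exp hc ht (hb t ht) (hb t ht)
  have ie : IntegrableOn (cohEnergyDensity ω₂ lam β γ T N x) (Ioi 0) := by
    unfold cohEnergyDensity
    refine (((i2 _ (hmc x) fun t ht => hC _ t (hmb x t ht)).fun_add
      ((i2 _ (hnc x) fun t ht => hC _ t (hnb x t ht)).const_mul ω₂)).div_const 2).fun_add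
      ((integrable_finsetSum _ fun b' _ => ?_).const_mul (1 / 4))
    by_cases h : (b' : ℕ) = (x : ℕ) ∨ (b' : ℕ) + 1 = (x : ℕ)
    · simp only [if_pos h]
      exact i2 _ ((hnc _).sub (hnc _)) fun t ht => abs_sub_le_of_abs_le (hnb _ t ht) (hnb _ t ht)
    · simp only [if_neg h]
      exact integrable_zero _ _ _
  have hpt : ∀ t, momResp ω₂ lam β γ T N x t ^ 2 ≤ 2 * cohEnergyDensity ω₂ lam β γ T N x t := by
    intro t
    unfold cohEnergyDensity
    have h1 : 0 ≤ ω₂ * posResp ω₂ lam β γ T N x t ^ 2 := by positivity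
    have h2 : 0 ≤ ∑ b : Fin N, (if (b : ℕ) = (x : ℕ) ∨ (b : ℕ) + 1 = (x : ℕ) then
        (posResp ω₂ lam β γ T N b.succ t - posResp ω₂ lam β γ T N b.castSucc t) ^ 2 else 0) :=
      Finset.sum_nonneg fun b _ => by split_ifs <;> positivity
    nlinarith
  calc ∫ t in Ioi (0 : ℝ), momResp ω₂ lam β γ T N x t ^ 2
      ≤ ∫ t in Ioi (0 : ℝ), 2 * cohEnergyDensity ω₂ lam β γ T N x t :=
        integral_mono_of_nonneg (Eventually.of_forall fun t => sq_nonneg _) (ie.const_mul 2)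
          (Eventually.of_forall hpt)
    _ = 2 * cohEnergy ω₂ lam β γ T N x := by
        unfold cohEnergy
        exact integral_const_mul _ _

end Summit.AtomisticToContinuum.FouriersLaw.Theorems.CoherentDephasing.LossComposition

end
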